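import Literature.AlgebraicGeometry.Motives.AbelianVarietyQuotientGroup
import Literature.NumberTheory.DiophantineGeometry.AVIsogenyQuasiInverse
import Literature.NumberTheory.DiophantineGeometry.AVGaloisModuleProofs
import Literature.AlgebraicGeometry.Motives.ZetaFunctionProofs
import Mathlib.FieldTheory.Normal.Closure
import HarnessLib

/-!
# The quotient of an abelian variety by a finite `Γ_K`-stable subgroup of `P(K̄)`

The existence half of Kieffer 2024, Prop. 1.1.10 (Mumford, *Abelian Varieties*, §7 Thm. 4
p. 72, §12 Thm. 1) in the language of geometric points: for `K` perfect, `S ⊆ P(K̄)` a finite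
`Γ_K`-stable subgroup killed by an isogeny `q : P → P`, there is an isogeny `h : P → P/S` of
abelian varieties over `K` with `ker h (K̄) = S` and `Ker h ⊆ Ker q` scheme-theoretically
(`exists_isogeny_geomKer_eq_of_isIsogeny`). The quotient is `AbelianVariety.quot` of
`AbelianVarietyQuotientGroup` for a finite Galois extension `L ⊆ K̄` over which the points of `S`
are defined (`AlgPoints.exists_fixingSubgroup_le_stabilizer`, `AlgPoints.mem_range_precomp`)
and the preimage `S_L ⊆ P(L)` of `S` (`subgroupOfGeomPoints`).

## References

* [Kieffer2024IsogenyGraphs] J. Kieffer, *Isogeny graphs of abelian varieties over finite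
  fields*, Prop. 1.1.10 (p. 10).
* [MumfordAV1970] D. Mumford, *Abelian Varieties*, §7 Thm. 4 (p. 72), §12 Thm. 1.
-/

noncomputable section

universe u

open CategoryTheory CategoryTheory.Limits AlgebraicGeometry

namespace Literature.AlgebraicGeometry.Motives

namespace AbelianVariety

open scoped MonObj

variable {K : Type u} [Field K] (P : AbelianVariety K)

/-! ### The quotient of `P` by a finite `Γ_K`-stable subgroup of `P(K̄)` (Kieffer Prop. 1.1.10) -/

section GeomQuotient

variable {L : Type u} [Field L] [Algebra K L]

/-- The preimage in `P(L)` of a subgroup `S ⊆ P(K̄)` (written additively) under the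
restriction of points along a `K`-morphism `s : Spec K̄ → Spec L`. [folklore] -/
def subgroupOfGeomPoints (S : AddSubgroup P.geomPoints)
    (s : specOver K (AlgebraicClosure K) ⟶ specOver K L) : Subgroup (P.Points L) where
  carrier := {y | Additive.ofMul (s ≫ y) ∈ S}
  one_mem' := by
    change Additive.ofMul (s ≫ (1 : P.Points L)) ∈ S
    rw [MonObj.comp_one]
    exact S.zero_mem
  mul_mem' {a b} ha hb := by
    change Additive.ofMul (s ≫ (a * b)) ∈ S
    rw [MonObj.comp_mul, ofMul_mul]
    exact S.add_mem ha hb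
  inv_mem' {a} ha := by
    change Additive.ofMul (s ≫ a⁻¹) ∈ S
    rw [GrpObj.comp_inv, ofMul_inv]
    exact S.neg_mem ha

/-- Membership in `subgroupOfGeomPoints`. [folklore] -/
theorem mem_subgroupOfGeomPoints_iff (S : AddSubgroup P.geomPoints)
    (s : specOver K (AlgebraicClosure K) ⟶ specOver K L) (y : P.Points L) :
    y ∈ P.subgroupOfGeomPoints S s ↔ Additive.ofMul (s ≫ y) ∈ S :=
  Iff.rfl

end GeomQuotient

/-- **The quotient of `P` by a finite `Γ_K`-stable subgroup of `P(K̄)` killed by an isogeny**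
(Kieffer 2024, Prop. 1.1.10, existence half; Mumford, *Abelian Varieties*, §7 Thm. 4 p. 72 and
§12 Thm. 1): for `K` perfect, `S ⊆ P(K̄)` a finite `Γ_K`-stable subgroup and `q : P → P` an
isogeny with `q(S) = 0`, there are an abelian variety `B = P/S` over `K` and an isogeny
`h : P → B` with `ker h (K̄) = S` and `Ker h ⊆ Ker q` scheme-theoretically
(`Ker h (T) ≤ Ker q (T)` for every `K`-scheme `T`).

Construction: the points of the finite `S` are defined over a finite Galois extension
`L ⊆ K̄` of `K` (`AlgPoints.exists_fixingSubgroup_le_stabilizer`, normal closure,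
`AlgPoints.mem_range_precomp`); with `S_L ⊆ P(L)` its preimage (stable under `Gal(L/K)` by the
`Γ_K`-stability of `S`, killed by `q`), `B` is the quotient abelian variety `AbelianVariety.quot`
— the `K`-scheme `(P_L)/(S_L ⋊ Gal(L/K))` with the group law descended along the flat
surjective `h : P → B` — and the kernel statements are `comp_quotientMapOver_eq_one_iff` and
`comp_eq_one_of_comp_quotientMapOver_eq_one`. [cite: Kieffer2024IsogenyGraphs, Prop. 1.1.10] -/
theorem exists_isogeny_geomKer_eq_of_isIsogeny [PerfectField K] (S : AddSubgroup P.geomPoints)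
    (hSfin : (S : Set P.geomPoints).Finite)
    (hS : ∀ (σ : Field.absoluteGaloisGroup K) (x : P.geomPoints), x ∈ S → σ • x ∈ S)
    (q : P ⟶ P) (hq : IsIsogeny q) (hSq₀ : ∀ x ∈ S, Hom.geomPointsMap q x = 0) :
    ∃ (B : AbelianVariety K) (h : P ⟶ B), IsIsogeny h ∧
      (∀ x : P.geomPoints, Hom.geomPointsMap h x = 0 ↔ x ∈ S) ∧
      ∀ T : SchemeOver K, Hom.kerPoints T h ≤ Hom.kerPoints T q := by
  classical
  haveI : IsGalois K (AlgebraicClosure K) := {}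
  haveI : Finite S := hSfin.to_subtype
  -- Step 2: a finite Galois extension `L ⊆ K̄` of `K` over which the points of `S` are defined
  have key : ∀ x : S, ∃ E : IntermediateField K (AlgebraicClosure K), FiniteDimensional K E ∧
      E.fixingSubgroup ≤ MulAction.stabilizer (AlgebraicClosure K ≃ₐ[K] AlgebraicClosure K)
        (Additive.toMul (x : P.geomPoints) : P.Points (AlgebraicClosure K)) :=
    fun x ↦ AlgPoints.exists_fixingSubgroup_le_stabilizer _
  choose E hEfin hEstab using key
  haveI := hEfin
  let E₀ : IntermediateField K (AlgebraicClosure K) := ⨆ x : S, E x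
  let Lf : IntermediateField K (AlgebraicClosure K) :=
    IntermediateField.normalClosure K E₀ (AlgebraicClosure K)
  haveI : IsGalois K Lf := {}
  have hstab : ∀ x : S, ∀ τ ∈ Lf.fixingSubgroup,
      τ • (Additive.toMul (x : P.geomPoints) : P.Points (AlgebraicClosure K)) =
        Additive.toMul (x : P.geomPoints) := fun x τ hτ ↦
    hEstab x (IntermediateField.fixingSubgroup_antitone
      ((le_iSup (fun x : S ↦ E x) x).trans (IntermediateField.le_normalClosure E₀)) hτ)
  -- the `K`-morphism `Spec K̄ → Spec L`
  let s : specOver K (AlgebraicClosure K) ⟶ specOver K Lf :=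
    AlgPoints.specOverMap Lf (AlgebraicClosure K)
  have hs : s.left = Spec.map (CommRingCat.ofHom ((IsScalarTower.toAlgHom K Lf
      (AlgebraicClosure K) : Lf →ₐ[K] AlgebraicClosure K) : Lf →+* AlgebraicClosure K)) := rfl
  haveI : Epi s.left := AlgPoints.epi_specMap_algebraMap Lf (AlgebraicClosure K)
  haveI : Epi s := Over.epi_of_epi_left s
  -- Step 3: the points of `S` descend to `L`
  have hdesc : ∀ x : S, ∃ y : P.Points Lf,
      s ≫ y = (Additive.toMul (x : P.geomPoints) : P.Points (AlgebraicClosure K)) := by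
    intro x
    obtain ⟨y, hy⟩ := AlgPoints.mem_range_precomp (X := P.X) hs
      (Additive.toMul (x : P.geomPoints) : P.Points (AlgebraicClosure K)) (fun t ↦ by
        have ht : AlgPoints.resHom (Additive.toMul (x : P.geomPoints) :
            P.Points (AlgebraicClosure K)) t ∈ Lf := by
          rw [← InfiniteGalois.fixedField_fixingSubgroup Lf, IntermediateField.mem_fixedField_iff]
          exact fun τ hτ ↦ AlgPoints.apply_resHom_of_smul_eq τ _ (hstab x τ hτ) t
        exact ⟨⟨_, ht⟩, rfl⟩)
    exact ⟨y, hy⟩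
  -- Step 4: the subgroup `S_L ⊆ P(L)` and its properties
  let SL : Subgroup (P.Points Lf) := P.subgroupOfGeomPoints S s
  have hinj : ∀ y₁ y₂ : P.Points Lf, s ≫ y₁ = s ≫ y₂ → y₁ = y₂ := fun y₁ y₂ h ↦
    (cancel_epi s).mp h
  haveI : Finite SL := by
    refine Finite.of_injective (fun y : SL ↦ (⟨Additive.ofMul (s ≫ (y : P.Points Lf)), y.2⟩ : S))
      fun y₁ y₂ h ↦ Subtype.ext (hinj _ _ ?_)
    exact Additive.ofMul.injective (congrArg Subtype.val h)
  have hSL : ∀ (σ : Lf ≃ₐ[K] Lf) (y : P.Points Lf), y ∈ SL → σ • y ∈ SL := by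
    intro σ y hy
    obtain ⟨τ, rfl⟩ := AlgEquiv.restrictNormalHom_surjective (F := K) (K₁ := Lf)
      (E := AlgebraicClosure K) σ
    change Additive.ofMul (s ≫ (AlgPoints.specMap (τ.restrictNormal Lf) ≫ y)) ∈ S
    have hsτ : s ≫ AlgPoints.specMap (τ.restrictNormal Lf) = AlgPoints.specMap τ ≫ s := by
      ext : 1
      change Spec.map (CommRingCat.ofHom (algebraMap Lf (AlgebraicClosure K))) ≫
          Spec.map (CommRingCat.ofHom ((τ.restrictNormal Lf : Lf ≃ₐ[K] Lf) : Lf →+* Lf)) =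
        Spec.map (CommRingCat.ofHom ((τ : AlgebraicClosure K ≃ₐ[K] AlgebraicClosure K) :
          AlgebraicClosure K →+* AlgebraicClosure K)) ≫
          Spec.map (CommRingCat.ofHom (algebraMap Lf (AlgebraicClosure K)))
      rw [← Spec.map_comp, ← Spec.map_comp, ← CommRingCat.ofHom_comp, ← CommRingCat.ofHom_comp]
      congr 2
      ext z
      exact AlgEquiv.restrictNormal_commutes τ Lf z
    rw [← Category.assoc, hsτ, Category.assoc]
    have h := hS ((Field.absoluteGaloisGroup.toAlgEquiv K).symm τ) _ hy
    rwa [← ofMul_smul, AlgPoints.absoluteGaloisGroup_smul_def, MulEquiv.apply_symm_apply] at h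
  -- the isogeny `q` kills `S_L`
  haveI : IsFinite (Hom.toSchemeHom q) := hq.2
  have hSq : ∀ y ∈ SL, y ≫ q.hom.hom.hom = 1 := by
    intro y hy
    apply hinj
    have h := hSq₀ _ hy
    rw [Hom.geomPointsMap_ofMul] at h
    have h' : AlgPoints.map q.hom.hom.hom (s ≫ y) = 1 := congrArg Additive.toMul h
    rw [AlgPoints.map_apply, Category.assoc] at h'
    rw [h', MonObj.comp_one]
  -- Step 5: the quotient
  refine ⟨P.quot Lf SL hSL _ hSq hq.2, P.quotHom Lf SL hSL _ hSq hq.2,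
    P.isIsogeny_quotHom Lf SL hSL _ hSq hq.2, fun x ↦ ?_, fun T x hx ↦ ?_⟩
  · -- the kernel on geometric points
    have hlam : s.left ≫ bcSpec K Lf = bcSpec K (AlgebraicClosure K) := Over.w s
    have hsO : (Over.homMk s.left hlam : specOver K (AlgebraicClosure K) ⟶ specOver K Lf) = s :=
      rfl
    have hiff := P.comp_quotientMapOver_eq_one_iff Lf SL hSL _ hSq (bcSpec K (AlgebraicClosure K))
      s.left hlam (Additive.toMul x : P.Points (AlgebraicClosure K))
    rw [hsO] at hiff
    have e : Hom.geomPointsMap (P.quotHom Lf SL hSL _ hSq hq.2) x = 0 ↔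
        (Additive.toMul x : P.Points (AlgebraicClosure K)) ≫
          P.quotientMapOver Lf SL hSL _ hSq = 1 := by
      constructor
      · intro h0
        have h1 := congrArg Additive.toMul h0
        rw [Hom.geomPointsMap_apply, AlgPoints.map_apply] at h1
        exact h1
      · intro h1
        apply Additive.toMul.injective
        rw [Hom.geomPointsMap_apply, AlgPoints.map_apply]
        exact h1
    rw [e, hiff]
    constructor
    · rintro ⟨y, hy⟩
      have hx : x = Additive.ofMul (s ≫ (y : P.Points Lf)) := by
        rw [← hy]
        rfl
      rw [hx]
      exact y.2
    · intro hx
      obtain ⟨y, hy⟩ := hdesc ⟨x, hx⟩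
      refine ⟨⟨y, ?_⟩, ?_⟩
      · change Additive.ofMul (s ≫ y) ∈ S
        rw [hy]
        exact hx
      · change Additive.toMul x = s ≫ y
        rw [hy]
  · -- `Ker h ⊆ Ker q`
    rw [Hom.mem_kerPoints_iff] at hx ⊢
    exact P.comp_eq_one_of_comp_quotientMapOver_eq_one Lf SL hSL _ hSq x hx

end AbelianVariety

end Literature.AlgebraicGeometry.Motives
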